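import Summits.QuantumFields.BalabanUV.Beta.GAN24.QvOpSupLocality
import Literature.MathematicalPhysics.QuantumFieldTheory.Balaban1983to89.B5Hk163TorusHolderRate

/-!
# Row G-an2-4 ∕ (CONV-C) — INTERFACE REQUEST G-an2-4 (B5-1115-TABLE), item (E4): the fourth entry «|(ΔGJ)(x)| ≤ O(1)e^{−δ₀|y−y′|}|J|»
# of Bałaban's (1.110) for `G = Δ_a⁻¹ = (DeltaA n M a)⁻¹`, `U = 1`, REDUCED to the first entry and to the (1.126)-class piece `∂P∂*·G`
# — every torus, every `a > 0`, uniform in `n = η⁻¹`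

NOT IN PRINT; OUR BOOKKEEPING.  Cell `pub-balaban`, G-an2-4 crux team (coordinator ruling e34b3e0c (2)), leaf seat
`b2b-balaban-gan24-formalise-leaf-01` (gen 54), FILE 2 of 2 (journal l.28169), filed on the crux prover's «INTERFACE REQUEST G-an2-4: (B5-1115-TABLE)» (road-P2 owner
`b2b-balaban-gan24-p2` gen 28, `HOME/INBOX.md` 2026-08-21T05:44Z, journal `CLAIMS.log` l.27856) — the freeze's channel (ruling (0)); no Support
leaf, no new object, no Literature fact, 0 `def`, 0 `def … : Prop`.

THE PRINTED SENTENCE this serves (T. Bałaban, *Propagators and renormalization transformations for lattice gauge theories. I*, Commun.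
Math. Phys. **95** (1984) 17–40 = `Balaban1984PropagatorsI`, Prop. 1.2 (1.110) p. 35): «|(GJ)(x)|, |(∇GJ)(x)|, |(G∇*J)(x)|, |(ΔGJ)(x)| ≤
O(1)e^{−δ₀|y−y′|}|J| for x ∈ Δ̃(y), supp J ⊂ Δ̃(y′)», typed entry by entry as the named statements `Entry110G ∕ Entry110Grad ∕ Entry110GDiv ∕
Entry110Lap (d) (a) : Prop` of `Literature/…/B5Prop12Entries110` (gen 53 of this seat; entry 1 discharged there at `a = 1` from pv15's
`B5G183FreeRowSum` BY NAME).  The paper proves Prop. 1.2 through «G = G₀ + G₀∂P∂*G (1.132), where G₀ = (Δ + aQ*Q)⁻¹» (p. 39) and the kernel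
bound «|(∂P∂*)_{μ,ν}(x, x′)| ≦ O(1)e^{−δ′₀|x−x′|} (1.126)» (p. 38); THIS FILE isolates exactly that structure for the fourth entry.

WHAT IS PROVED (kernel, 0 sorry; constants ours; `Δ = B5Prop11Lower.Lap`, `∂ = B5Action121.GradOp (fine n M) n`, `P = B5Value126.PcT n M n`,
`Q = B5Block118.QvOp n M` ((1.18)), `Q* = B5DeltaA169.QvAdj n M = n^{d}•Qᴴ`, `Δ_a = B5DeltaA169.DeltaA n M a = Δ − ∂P∂ᴴ + a•Q*Q`):
 * §1 `Lap_mul_DeltaA_inv` ∕ `Lap_DeltaA_inv_mulVec`: **`Δ·Δ_a⁻¹ = 1 + ∂P∂ᴴ·Δ_a⁻¹ − a•Q*Q·Δ_a⁻¹`** (`n ≥ 1`, `a > 0`; `B5DeltaA169.isUnit_DeltaA`);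
 * (FILE 1 `GAN24/QvOpSupLocality`, imported BY NAME: the contour-point lemma `bpt_toT_add_tstep`, the torus-distance bookkeeping, and the
   locality of `Q_k` in sup currency `norm_QvOp_mulVec_le` ∕ `norm_QvOp_conjTranspose_mulVec_le`);
 * §2 **`entry110Lap_of : 0 < a → Entry110G d a → (E_P) → Entry110Lap d a`**, where (E_P) — written INLINE, in the currency of `B5Prop12Entries110`,
   no named Prop — is the localized sup decay of the non-local piece `∂·P·∂ᴴ·Δ_a⁻¹·J` (the item located by `b2b-balaban-beta-d4-p2`'s FIT NOTE,
   journal l.27939); constants `δ = min(δ_G, δ_P)`, `C = 1 + C_P + 2a·C_G·e^{δ_G}`; and **`entry110Lap_one_of : (E_P at a = 1) → Entry110Lap d 1`**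
   (entry 1 from the tree, `B5Prop12Entries110.entry110G_one`);
 * §3 **`entryP_of_kernel_decay : Entry110G d a → (K) → (E_P)`** and **`entry110Lap_one_of_kernel_decay : (K at a = 1) → Entry110Lap d 1`**, where
   (K) is the (1.126)-SHAPE ENTRY DECAY OF THE LITERAL MATRIX `GradOp·PcT·GradOpᴴ` on `T_η`: `|(∂P∂ᴴ)((x,μ),(x″,ν))| ≤ C·η^{d+1}·e^{−δ|y−y″|_{T₁}}`
   (`x ∈ B(y)`, `x″ ∈ B(y″)`), via the block decomposition of `T_η` and the volume-uniform torus sum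
   `B5Hk163TorusHolderRate.sum_exp_torusSupNorm_sub_rep_le`; constants `δ = min(δ_G, δ_K)/2`, `C = (d+1)·C_K·C_G·K_{d+1}(δ) + 1`.

HONEST SCOPE.  A REDUCTION, NOT A DISCHARGE: (E4) is proved CONDITIONALLY on (E_P), resp. on (K); neither (E_P) nor (K) is proved here, for any
`a`.  (K) is certified in the tree ONLY for the `U = 1` torus multiplier MODEL (`B5DPD126Uniform.matrixP_decay_uniform`, `B5Kernel126TorusInstance`),
whose identification with the literal `B5Value126.PcT` on `Tor (fine n M)` (carrier `Π_μ Fin (n·N_μ)` and the representation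
«P = G′Q′*(Q′G′²Q′*)⁻¹Q′G′» versus (1.70) «P = Δ⁻¹Q′*(Q′Δ⁻²Q′*)⁻¹Q′Δ⁻¹») is NOT in the tree — that is the ONE remaining input of (E4) at `a = 1`
on every torus by this route.  COMPLEMENT (journal l.28153 ∕ l.28179): `b2b-balaban-gan24-formalise-leaf-04` gen 46 closes (E2)–(E4) at `a = 1`
UNCONDITIONALLY on CUBIC unit tori through NE3's flat-slice resolvent (`GAN24/Entry110*Cubic`); the present file is torus-general and isolates the
rectangular case's missing input.  (E2) `Entry110Grad`, (E3) `Entry110GDiv`, (H) (1.111)–(1.117) untouched here.  Unit cubes for the printed `Δ̃`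
(as in `B5Prop12Entries110`).  Nothing printed is used as a hypothesis: (E_P) and (K) are OUR statements about the tree's literal matrices,
binders to be discharged, never cited.  NOT (CONV-C), NEVER «G-an2-4 closed», NOT NE2, NOT D1, NOT BetaPertH, NOT the continuum limit, NOT Clay.
HONEST DEPENDENCY: continuum YM on T⁴ ⇐ BetaPertH ∧ nine spine estimates (0/9 proved); BetaPertH ⇐ (D1) ∧ (D4) ∧ CAP+tail; G-an2-4 gates
asym, D1 and NE2/3/4.
-/

noncomputable section

open scoped BigOperators Matrix ComplexConjugate
open Finset Complex Matrix

namespace Summit.QuantumFields.BalabanUV.Beta.GAN24.Entry110LapReduction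

open Literature.MathematicalPhysics.QuantumFieldTheory.Balaban1983to89
open B5Prop11Plancherel (Tor fine)
open B5Prop11Lower (Lap)
open B5Block118 (bpt QvOp)
open B5Blocks16 (bpt_injective bpt_bijective)
open B5DeltaA169 (DeltaA QvAdj QvAdj_mulVec isUnit_DeltaA)
open B5Action121 (GradOp)
open B5Value126 (PcT)
open B6LowerBound2153Torus (toT rep toT_rep)
open B6BondElimination (unitVec)
open B4TorusKernel.MultiPeriod (torusSupNorm torusSupNorm_nonneg)
open B6Cov2156Torus (one_le_M)
open B5Prop12Entries110 (Entry110G Entry110Lap entry110G_one)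
open B5Hk163TorusHolderRate (sum_exp_torusSupNorm_sub_rep_le)
open B4Sect5Proof (latticeConst latticeConst_nonneg)
open Summit.QuantumFields.BalabanUV.Beta.GAN24.QvOpSupLocality
  (torusSupNorm_sub_eq_zero_of_toT_eq torusSupNorm_add_le' exp_le_of_near norm_QvOp_mulVec_le norm_QvOp_conjTranspose_mulVec_le)

variable {d : ℕ}

/-! ## §1 The operator identity `Δ·G = 1 + ∂P∂ᴴ·G − a·Q*Q·G` for `G = Δ_a⁻¹` -/

section Identity

variable (n : ℕ) [NeZero n] (M : Fin d → ℕ) [hM : ∀ μ, NeZero (M μ)] (a : ℝ)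

/-- `Δ = Δ_a + ∂P∂* − aQ*Q` — the definition (1.69)/(1.73) of `Δ_a = Δ − ∂P∂* + aQ*Q` (`B5DeltaA169.DeltaA`)
solved for the Laplacian. [folklore] -/
theorem Lap_eq_DeltaA_add_sub :
    Lap n M = DeltaA n M a + GradOp (fine n M) (n : ℂ) * PcT n M (n : ℂ) * (GradOp (fine n M) (n : ℂ))ᴴ
      - (a : ℂ) • (QvAdj n M * QvOp n M) := by
  rw [DeltaA]; abel

/-- **`Δ·Δ_a⁻¹ = 1 + ∂P∂*·Δ_a⁻¹ − a·Q*Q·Δ_a⁻¹`** for `n ≥ 1`, `a > 0` (then `Δ_a` is invertible,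
`B5DeltaA169.isUnit_DeltaA`): the exact splitting behind the fourth entry of (1.110). [folklore] -/
theorem Lap_mul_DeltaA_inv (hn : 1 ≤ n) (ha : 0 < a) :
    Lap n M * (DeltaA n M a)⁻¹
      = 1 + GradOp (fine n M) (n : ℂ) * PcT n M (n : ℂ) * (GradOp (fine n M) (n : ℂ))ᴴ * (DeltaA n M a)⁻¹
          - (a : ℂ) • (QvAdj n M * QvOp n M * (DeltaA n M a)⁻¹) := by
  have hU : IsUnit (DeltaA n M a).det :=
    (Matrix.isUnit_iff_isUnit_det _).mp (isUnit_DeltaA n hn M a ha)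
  rw [Lap_eq_DeltaA_add_sub n M a, sub_mul, add_mul, Matrix.mul_nonsing_inv _ hU, Matrix.smul_mul]

/-- the same identity applied to a field `J`: `Δ(GJ) = J + ∂(P(∂ᴴ(GJ))) − a·n^d·Qᴴ(Q(GJ))`
(`Q* = n^d·Qᴴ`, `B5DeltaA169.QvAdj`). [folklore] -/
theorem Lap_DeltaA_inv_mulVec (hn : 1 ≤ n) (ha : 0 < a) (J : Tor (fine n M) × Fin d → ℂ) :
    Lap n M *ᵥ ((DeltaA n M a)⁻¹ *ᵥ J)
      = J + GradOp (fine n M) (n : ℂ) *ᵥ (PcT n M (n : ℂ) *ᵥ ((GradOp (fine n M) (n : ℂ))ᴴ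
            *ᵥ ((DeltaA n M a)⁻¹ *ᵥ J)))
          - ((a : ℂ) * (n : ℂ) ^ d) • ((QvOp n M)ᴴ *ᵥ (QvOp n M *ᵥ ((DeltaA n M a)⁻¹ *ᵥ J))) := by
  rw [Matrix.mulVec_mulVec, Lap_mul_DeltaA_inv n M a hn ha, Matrix.sub_mulVec, Matrix.add_mulVec,
    Matrix.one_mulVec, Matrix.smul_mulVec, ← Matrix.mulVec_mulVec, ← Matrix.mulVec_mulVec,
    ← Matrix.mulVec_mulVec, ← Matrix.mulVec_mulVec, ← Matrix.mulVec_mulVec, QvAdj_mulVec, smul_smul]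

end Identity

/-! ## §2 THE REDUCTION: (E4) `Entry110Lap` from entry 1 `Entry110G` and the (1.126)-class piece `∂P∂ᴴ·G` -/

section Reduction

variable (d)

/-- **(E4) ⇐ (E1) ∧ (E_P).**  For `a > 0`: if the first entry of (1.110) holds for `G = Δ_a⁻¹` (`Entry110G d a`) and
the non-local term `∂·P·∂ᴴ·G` obeys the same localized sup bound (hypothesis `hP`, written out in the currency of
`B5Prop12Entries110` — NOT a printed statement, the (1.126)-class piece located by beta-d4-p2's fit note), then the
fourth entry «|(ΔGJ)(x)| ≤ O(1)e^{−δ₀|y−y′|}|J|» holds (`Entry110Lap d a`), with `δ = min(δ_G, δ_P)` and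
`C = 1 + C_P + 2a·C_G·e^{δ_G}`; via `Δ·G = 1 + ∂P∂ᴴ·G − a·Q*Q·G` (§1), the support of `J` (term `1`) and the
locality of `Q_k` (`GAN24/QvOpSupLocality`, term `Q*Q·G`). [folklore] -/
theorem entry110Lap_of {a : ℝ} (ha : 0 < a) (hG : Entry110G d a)
    (hP : ∃ δ C : ℝ, 0 < δ ∧ 0 < C ∧
      ∀ (n : ℕ) (M : Fin (d + 1) → ℕ) [NeZero n] [∀ μ, NeZero (M μ)], 1 ≤ n →
        ∀ (y y' : Fin (d + 1) → ℤ) (J : Tor (fine n M) × Fin (d + 1) → ℂ) (B : ℝ),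
          (∀ j, ‖J j‖ ≤ B) → (∀ j, J j ≠ 0 → ∃ r' : Fin (d + 1) → Fin n, j.1 = bpt n M (toT M y') r') →
          ∀ (r : Fin (d + 1) → Fin n) (μ : Fin (d + 1)),
            ‖(GradOp (fine n M) (n : ℂ) *ᵥ (PcT n M (n : ℂ) *ᵥ ((GradOp (fine n M) (n : ℂ))ᴴ
                *ᵥ ((DeltaA n M a)⁻¹ *ᵥ J)))) (bpt n M (toT M y) r, μ)‖
              ≤ C * Real.exp (-(δ * torusSupNorm M (y - y'))) * B) :
    Entry110Lap d a := by
  obtain ⟨δ₀, C₀, hδ₀, hC₀, hG⟩ := hG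
  obtain ⟨δ₁, C₁, hδ₁, hC₁, hP⟩ := hP
  refine ⟨min δ₀ δ₁, 1 + C₁ + 2 * a * C₀ * Real.exp δ₀, lt_min hδ₀ hδ₁, by positivity, ?_⟩
  intro n M _ _ hn y y' J B hJB hsupp r μ
  set T : ℝ := torusSupNorm M (y - y') with hT
  set E : ℝ := Real.exp (-(min δ₀ δ₁ * T)) with hE
  have hB0 : 0 ≤ B := (norm_nonneg _).trans (hJB (bpt n M (toT M y) r, μ))
  have hT0 : 0 ≤ T := torusSupNorm_nonneg (one_le_M M) _
  have hE0 : 0 ≤ E := (Real.exp_pos _).le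
  have e0 : Real.exp (-(δ₀ * T)) ≤ E :=
    Real.exp_le_exp.mpr (by nlinarith [mul_le_mul_of_nonneg_right (min_le_left δ₀ δ₁) hT0])
  have e1 : Real.exp (-(δ₁ * T)) ≤ E :=
    Real.exp_le_exp.mpr (by nlinarith [mul_le_mul_of_nonneg_right (min_le_right δ₀ δ₁) hT0])
  -- (T1) the source term itself
  have hT1 : ‖J (bpt n M (toT M y) r, μ)‖ ≤ E * B := by
    by_cases hJ : J (bpt n M (toT M y) r, μ) = 0
    · rw [hJ, norm_zero]; positivity
    · obtain ⟨r', hr'⟩ := hsupp _ hJ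
      have hyy : toT M y = toT M y' :=
        congrArg Prod.fst (bpt_injective n M (a₁ := (toT M y, r)) (a₂ := (toT M y', r')) hr')
      have hT' : T = 0 := torusSupNorm_sub_eq_zero_of_toT_eq M hyy
      rw [hE, hT', mul_zero, neg_zero, Real.exp_zero, one_mul]
      exact hJB _
  -- (T2) the non-local term: hypothesis
  have hT2 := hP n M hn y y' J B hJB hsupp r μ
  -- (T3) the averaging term
  set v := (DeltaA n M a)⁻¹ *ᵥ J with hv
  set F : (Fin (d + 1) → ℤ) → ℝ := fun z => C₀ * Real.exp (-(δ₀ * torusSupNorm M (z - y'))) * B with hF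
  have hF0 : ∀ z, 0 ≤ F z := fun z => by positivity
  have hFv : ∀ (z : Fin (d + 1) → ℤ) (r' : Fin (d + 1) → Fin n) (μ' : Fin (d + 1)),
      ‖v (bpt n M (toT M z) r', μ')‖ ≤ F z := fun z r' μ' => hG n M hn z y' J B hJB hsupp r' μ'
  have hS : ∀ z : Fin (d + 1) → ℤ, (toT M z = toT M y ∨ toT M (z + unitVec μ) = toT M y) →
      ‖(QvOp n M *ᵥ v) (toT M z, μ)‖ ≤ 2 * C₀ * Real.exp δ₀ * Real.exp (-(δ₀ * T)) * B := by
    intro z hz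
    obtain ⟨h1, h2⟩ := exp_le_of_near M hδ₀.le z y y' μ hz
    have hq := norm_QvOp_mulVec_le n M v F hF0 hFv z μ
    have hC0B : 0 ≤ C₀ * B := by positivity
    calc ‖(QvOp n M *ᵥ v) (toT M z, μ)‖ ≤ F z + F (z + unitVec μ) := hq
      _ ≤ C₀ * (Real.exp δ₀ * Real.exp (-(δ₀ * T))) * B + C₀ * (Real.exp δ₀ * Real.exp (-(δ₀ * T))) * B := by
          simp only [hF]
          gcongr
      _ = 2 * C₀ * Real.exp δ₀ * Real.exp (-(δ₀ * T)) * B := by ring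
  have hT3 := norm_QvOp_conjTranspose_mulVec_le n M (QvOp n M *ᵥ v) y r μ (S := _) (by positivity) hS
  -- assemble
  have hn0 : (n : ℝ) ≠ 0 := by exact_mod_cast NeZero.ne n
  have hsc : ‖((a : ℂ) * (n : ℂ) ^ (d + 1))‖ = a * (n : ℝ) ^ (d + 1) := by
    rw [norm_mul, norm_pow, Complex.norm_real, Complex.norm_natCast, Real.norm_of_nonneg ha.le]
  rw [Lap_DeltaA_inv_mulVec n M a hn ha J]
  simp only [Pi.add_apply, Pi.sub_apply, Pi.smul_apply, smul_eq_mul]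
  calc ‖J (bpt n M (toT M y) r, μ)
        + (GradOp (fine n M) (n : ℂ) *ᵥ (PcT n M (n : ℂ) *ᵥ ((GradOp (fine n M) (n : ℂ))ᴴ *ᵥ v)))
            (bpt n M (toT M y) r, μ)
        - (a : ℂ) * (n : ℂ) ^ (d + 1) * ((QvOp n M)ᴴ *ᵥ (QvOp n M *ᵥ v)) (bpt n M (toT M y) r, μ)‖
      ≤ ‖J (bpt n M (toT M y) r, μ)‖
        + ‖(GradOp (fine n M) (n : ℂ) *ᵥ (PcT n M (n : ℂ) *ᵥ ((GradOp (fine n M) (n : ℂ))ᴴ *ᵥ v)))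
            (bpt n M (toT M y) r, μ)‖
        + ‖(a : ℂ) * (n : ℂ) ^ (d + 1) * ((QvOp n M)ᴴ *ᵥ (QvOp n M *ᵥ v)) (bpt n M (toT M y) r, μ)‖ :=
        (norm_sub_le _ _).trans (add_le_add (norm_add_le _ _) le_rfl)
    _ ≤ E * B + C₁ * Real.exp (-(δ₁ * T)) * B
        + a * (n : ℝ) ^ (d + 1) * (2 * C₀ * Real.exp δ₀ * Real.exp (-(δ₀ * T)) * B / (n : ℝ) ^ (d + 1)) := by
        rw [norm_mul, hsc]
        gcongr
    _ = E * B + C₁ * Real.exp (-(δ₁ * T)) * B + 2 * a * C₀ * Real.exp δ₀ * Real.exp (-(δ₀ * T)) * B := by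
        field_simp
    _ ≤ E * B + C₁ * E * B + 2 * a * C₀ * Real.exp δ₀ * E * B := by
        have h2 : 0 ≤ 2 * a * C₀ * Real.exp δ₀ := by positivity
        nlinarith [mul_le_mul_of_nonneg_left e1 hC₁.le, mul_le_mul_of_nonneg_left e0 h2,
          mul_nonneg (mul_nonneg hC₁.le hE0) hB0]
    _ = (1 + C₁ + 2 * a * C₀ * Real.exp δ₀) * E * B := by ring

/-- **(E4) AT `a = 1` MODULO THE (1.126)-CLASS PIECE**: with the first entry discharged in the tree
(`B5Prop12Entries110.entry110G_one`, from pv15's `B5G183FreeRowSum` BY NAME), the fourth entry of (1.110) for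
`G = Δ_1⁻¹` follows from the localized sup decay of `∂·P·∂ᴴ·G` alone. [folklore] -/
theorem entry110Lap_one_of
    (hP : ∃ δ C : ℝ, 0 < δ ∧ 0 < C ∧
      ∀ (n : ℕ) (M : Fin (d + 1) → ℕ) [NeZero n] [∀ μ, NeZero (M μ)], 1 ≤ n →
        ∀ (y y' : Fin (d + 1) → ℤ) (J : Tor (fine n M) × Fin (d + 1) → ℂ) (B : ℝ),
          (∀ j, ‖J j‖ ≤ B) → (∀ j, J j ≠ 0 → ∃ r' : Fin (d + 1) → Fin n, j.1 = bpt n M (toT M y') r') →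
          ∀ (r : Fin (d + 1) → Fin n) (μ : Fin (d + 1)),
            ‖(GradOp (fine n M) (n : ℂ) *ᵥ (PcT n M (n : ℂ) *ᵥ ((GradOp (fine n M) (n : ℂ))ᴴ
                *ᵥ ((DeltaA n M 1)⁻¹ *ᵥ J)))) (bpt n M (toT M y) r, μ)‖
              ≤ C * Real.exp (-(δ * torusSupNorm M (y - y'))) * B) :
    Entry110Lap d 1 :=
  entry110Lap_of d one_pos (entry110G_one d) hP

end Reduction


/-! ## §3 THE SECOND REDUCTION: the piece `∂P∂ᴴ·G` from entry 1 and a (1.126)-shape ENTRY decay of the LITERAL `∂·P·∂ᴴ` -/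

section KernelDecay

variable (d)

/-- **(E_P) ⇐ (E1) ∧ [(1.126)-shape entry decay of the literal matrix `∂·P·∂ᴴ = GradOp·PcT·GradOpᴴ`].**
If the counting-measure entries of `∂·P·∂ᴴ` on `T_η` obey `|(∂P∂ᴴ)((x,μ),(x″,ν))| ≤ C·η^{d+1}·e^{−δ|y−y″|_{T₁}}` for
`x ∈ B(y)`, `x″ ∈ B(y″)` (hypothesis `hK` — the shape of B5 (1.126) «|(∂P∂*)_{μν}(x,x′)| ≤ O(1)e^{−δ′₀|x−x′|}» for the
`η`-weighted kernel, distance in block units; in the tree it is CERTIFIED for the torus multiplier MODEL as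
`B5DPD126Uniform.matrixP_decay_uniform`, NOT for the literal `B5Value126.PcT` — that identification is the one input this
file does not supply), and the first entry of (1.110) holds (`Entry110G d a`), then `∂·P·∂ᴴ·G` obeys the localized sup
bound of `entry110Lap_of`'s hypothesis, with `δ = min(δ_G, δ_K)/2` and `C = (d+1)·C_K·C_G·K_{d+1}(δ) + 1`, by the block
decomposition of `T_η` and the volume-uniform torus sum `B5Hk163TorusHolderRate.sum_exp_torusSupNorm_sub_rep_le`. [folklore] -/
theorem entryP_of_kernel_decay {a : ℝ} (hG : Entry110G d a)
    (hK : ∃ δ C : ℝ, 0 < δ ∧ 0 < C ∧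
      ∀ (n : ℕ) (M : Fin (d + 1) → ℕ) [NeZero n] [∀ μ, NeZero (M μ)], 1 ≤ n →
        ∀ (y y'' : Fin (d + 1) → ℤ) (r r'' : Fin (d + 1) → Fin n) (μ ν : Fin (d + 1)),
          ‖(GradOp (fine n M) (n : ℂ) * PcT n M (n : ℂ) * (GradOp (fine n M) (n : ℂ))ᴴ)
              (bpt n M (toT M y) r, μ) (bpt n M (toT M y'') r'', ν)‖
            ≤ C / (n : ℝ) ^ (d + 1) * Real.exp (-(δ * torusSupNorm M (y - y'')))) :
    ∃ δ C : ℝ, 0 < δ ∧ 0 < C ∧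
      ∀ (n : ℕ) (M : Fin (d + 1) → ℕ) [NeZero n] [∀ μ, NeZero (M μ)], 1 ≤ n →
        ∀ (y y' : Fin (d + 1) → ℤ) (J : Tor (fine n M) × Fin (d + 1) → ℂ) (B : ℝ),
          (∀ j, ‖J j‖ ≤ B) → (∀ j, J j ≠ 0 → ∃ r' : Fin (d + 1) → Fin n, j.1 = bpt n M (toT M y') r') →
          ∀ (r : Fin (d + 1) → Fin n) (μ : Fin (d + 1)),
            ‖(GradOp (fine n M) (n : ℂ) *ᵥ (PcT n M (n : ℂ) *ᵥ ((GradOp (fine n M) (n : ℂ))ᴴ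
                *ᵥ ((DeltaA n M a)⁻¹ *ᵥ J)))) (bpt n M (toT M y) r, μ)‖
              ≤ C * Real.exp (-(δ * torusSupNorm M (y - y'))) * B := by
  obtain ⟨δ₀, C₀, hδ₀, hC₀, hG⟩ := hG
  obtain ⟨δ₁, C₁, hδ₁, hC₁, hK⟩ := hK
  have hδ₂ : 0 < min δ₀ δ₁ := lt_min hδ₀ hδ₁
  have hK0 : 0 ≤ latticeConst (d + 1) (min δ₀ δ₁ / 2) := latticeConst_nonneg _ (by positivity)
  refine ⟨min δ₀ δ₁ / 2, (d + 1) * C₁ * C₀ * latticeConst (d + 1) (min δ₀ δ₁ / 2) + 1, by positivity,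
    by positivity, ?_⟩
  intro n M _ _ hn y y' J B hJB hsupp r μ
  set δ₂ : ℝ := min δ₀ δ₁ with hδ₂_def
  set T : ℝ := torusSupNorm M (y - y') with hT
  set E : ℝ := Real.exp (-(δ₂ / 2 * T)) with hE
  set X := GradOp (fine n M) (n : ℂ) * PcT n M (n : ℂ) * (GradOp (fine n M) (n : ℂ))ᴴ with hX
  set v := (DeltaA n M a)⁻¹ *ᵥ J with hv
  set i : Tor (fine n M) × Fin (d + 1) := (bpt n M (toT M y) r, μ) with hi
  have hB0 : 0 ≤ B := (norm_nonneg _).trans (hJB (bpt n M (toT M y) r, μ))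
  have hT0 : 0 ≤ T := torusSupNorm_nonneg (one_le_M M) _
  have hE0 : 0 ≤ E := (Real.exp_pos _).le
  have hn0 : (n : ℝ) ≠ 0 := by exact_mod_cast NeZero.ne n
  rw [Matrix.mulVec_mulVec, Matrix.mulVec_mulVec]
  -- the entry as a sum over fine sites, re-indexed by blocks
  have h1 : ‖(X *ᵥ v) i‖ ≤ ∑ p : Tor M × (Fin (d + 1) → Fin n), ∑ ν : Fin (d + 1),
      ‖X i (bpt n M p.1 p.2, ν)‖ * ‖v (bpt n M p.1 p.2, ν)‖ := by
    have e : ∑ p : Tor M × (Fin (d + 1) → Fin n), ∑ ν : Fin (d + 1),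
        ‖X i (bpt n M p.1 p.2, ν)‖ * ‖v (bpt n M p.1 p.2, ν)‖ = ∑ k, ‖X i k‖ * ‖v k‖ := by
      rw [Fintype.sum_prod_type (f := fun k : Tor (fine n M) × Fin (d + 1) => ‖X i k‖ * ‖v k‖)]
      exact (bpt_bijective n M).sum_comp (fun x => ∑ ν : Fin (d + 1), ‖X i (x, ν)‖ * ‖v (x, ν)‖)
    rw [e]
    refine (norm_sum_le _ _).trans (Finset.sum_le_sum fun k _ => (norm_mul_le _ _))
  -- each block `B(ȳ″)` contributes `(d+1)·n^{d+1}` entries, each `≤ (C_K η^{d+1} e^{−δ_K|y−y″|})·(C_G e^{−δ_G|y″−y′|} B)`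
  have h2 : ∀ p : Tor M × (Fin (d + 1) → Fin n), ∑ ν : Fin (d + 1),
      ‖X i (bpt n M p.1 p.2, ν)‖ * ‖v (bpt n M p.1 p.2, ν)‖
        ≤ (d + 1) * ((C₁ / (n : ℝ) ^ (d + 1) * Real.exp (-(δ₁ * torusSupNorm M (y - rep M p.1))))
            * (C₀ * Real.exp (-(δ₀ * torusSupNorm M (rep M p.1 - y'))) * B)) := by
    intro p
    calc ∑ ν : Fin (d + 1), ‖X i (bpt n M p.1 p.2, ν)‖ * ‖v (bpt n M p.1 p.2, ν)‖
        ≤ ∑ _ν : Fin (d + 1), (C₁ / (n : ℝ) ^ (d + 1) * Real.exp (-(δ₁ * torusSupNorm M (y - rep M p.1))))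
            * (C₀ * Real.exp (-(δ₀ * torusSupNorm M (rep M p.1 - y'))) * B) := by
          refine Finset.sum_le_sum fun ν _ => ?_
          have hk := hK n M hn y (rep M p.1) r p.2 μ ν
          have hg := hG n M hn (rep M p.1) y' J B hJB hsupp p.2 ν
          rw [toT_rep] at hk hg
          exact mul_le_mul hk hg (norm_nonneg _) (by positivity)
      _ = _ := by rw [Finset.sum_const, Finset.card_univ, Fintype.card_fin, nsmul_eq_mul]; push_cast; ring
  -- the exponentials: `e^{−δ_K A}·e^{−δ_G B′} ≤ e^{−(δ₂/2)|y−y′|}·e^{−(δ₂/2) A}` by the triangle inequality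
  have h3 : ∀ t : Tor M,
      Real.exp (-(δ₁ * torusSupNorm M (y - rep M t))) * Real.exp (-(δ₀ * torusSupNorm M (rep M t - y')))
        ≤ E * Real.exp (-(δ₂ / 2 * torusSupNorm M (y - rep M t))) := by
    intro t
    have hA := torusSupNorm_nonneg (one_le_M M) (y - rep M t)
    have hB := torusSupNorm_nonneg (one_le_M M) (rep M t - y')
    have htri : T ≤ torusSupNorm M (y - rep M t) + torusSupNorm M (rep M t - y') := by
      have e : y - y' = (y - rep M t) + (rep M t - y') := by abel
      rw [hT, e]; exact torusSupNorm_add_le' M _ _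
    have hm0 : δ₂ ≤ δ₀ := min_le_left _ _
    have hm1 : δ₂ ≤ δ₁ := min_le_right _ _
    rw [← Real.exp_add, ← Real.exp_add]
    apply Real.exp_le_exp.mpr
    nlinarith [mul_le_mul_of_nonneg_right hm1 hA, mul_le_mul_of_nonneg_right hm0 hB,
      mul_le_mul_of_nonneg_left htri hδ₂.le, mul_nonneg hδ₂.le hB]
  -- assemble
  calc ‖(X *ᵥ v) i‖
      ≤ ∑ p : Tor M × (Fin (d + 1) → Fin n), ∑ ν : Fin (d + 1),
          ‖X i (bpt n M p.1 p.2, ν)‖ * ‖v (bpt n M p.1 p.2, ν)‖ := h1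
    _ ≤ ∑ p : Tor M × (Fin (d + 1) → Fin n),
          (d + 1) * ((C₁ / (n : ℝ) ^ (d + 1) * Real.exp (-(δ₁ * torusSupNorm M (y - rep M p.1))))
            * (C₀ * Real.exp (-(δ₀ * torusSupNorm M (rep M p.1 - y'))) * B)) :=
        Finset.sum_le_sum fun p _ => h2 p
    _ = ∑ t : Tor M, ∑ _r'' : Fin (d + 1) → Fin n,
          (d + 1) * ((C₁ / (n : ℝ) ^ (d + 1) * Real.exp (-(δ₁ * torusSupNorm M (y - rep M t))))
            * (C₀ * Real.exp (-(δ₀ * torusSupNorm M (rep M t - y'))) * B)) := Fintype.sum_prod_type _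
    _ = ∑ t : Tor M, (d + 1) * C₁ * C₀ * B *
          (Real.exp (-(δ₁ * torusSupNorm M (y - rep M t))) * Real.exp (-(δ₀ * torusSupNorm M (rep M t - y')))) := by
        refine Finset.sum_congr rfl fun t _ => ?_
        rw [Finset.sum_const, Finset.card_univ, Fintype.card_fun, Fintype.card_fin, Fintype.card_fin, nsmul_eq_mul]
        push_cast
        field_simp
    _ ≤ ∑ t : Tor M, (d + 1) * C₁ * C₀ * B * (E * Real.exp (-(δ₂ / 2 * torusSupNorm M (y - rep M t)))) := by
        refine Finset.sum_le_sum fun t _ => mul_le_mul_of_nonneg_left (h3 t) (by positivity)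
    _ = (d + 1) * C₁ * C₀ * B * E * ∑ t : Tor M, Real.exp (-(δ₂ / 2 * torusSupNorm M (y - rep M t))) := by
        rw [Finset.mul_sum]
        refine Finset.sum_congr rfl fun t _ => by ring
    _ ≤ (d + 1) * C₁ * C₀ * B * E * latticeConst (d + 1) (δ₂ / 2) :=
        mul_le_mul_of_nonneg_left (sum_exp_torusSupNorm_sub_rep_le M (by positivity) y) (by positivity)
    _ ≤ ((d + 1) * C₁ * C₀ * latticeConst (d + 1) (δ₂ / 2) + 1) * E * B := by
        nlinarith [mul_nonneg hE0 hB0]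

/-- **(E4) AT `a = 1` MODULO THE LITERAL (1.126).**  The fourth entry of (1.110) for `G = Δ_1⁻¹` (`Entry110Lap d 1`)
follows from a (1.126)-shape entry decay of the literal `GradOp·PcT·GradOpᴴ` ALONE (entry 1 is in the tree:
`B5Prop12Entries110.entry110G_one`).  The hypothesis is stated for the `U = 1` torus multiplier MODEL by
`B5DPD126Uniform.matrixP_decay_uniform`; transporting it to `B5Value126.PcT` on `Tor (fine n M)` is the ONE remaining
input — NOT supplied here. [folklore] -/
theorem entry110Lap_one_of_kernel_decay
    (hK : ∃ δ C : ℝ, 0 < δ ∧ 0 < C ∧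
      ∀ (n : ℕ) (M : Fin (d + 1) → ℕ) [NeZero n] [∀ μ, NeZero (M μ)], 1 ≤ n →
        ∀ (y y'' : Fin (d + 1) → ℤ) (r r'' : Fin (d + 1) → Fin n) (μ ν : Fin (d + 1)),
          ‖(GradOp (fine n M) (n : ℂ) * PcT n M (n : ℂ) * (GradOp (fine n M) (n : ℂ))ᴴ)
              (bpt n M (toT M y) r, μ) (bpt n M (toT M y'') r'', ν)‖
            ≤ C / (n : ℝ) ^ (d + 1) * Real.exp (-(δ * torusSupNorm M (y - y'')))) :
    Entry110Lap d 1 :=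
  entry110Lap_one_of d (entryP_of_kernel_decay d (entry110G_one d) hK)

end KernelDecay

end Summit.QuantumFields.BalabanUV.Beta.GAN24.Entry110LapReduction

end
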